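import Summits.Ventures.PercRepro.ProfileGapMonoColoopBandSucc

/-!
# PercRepro — GENERIC POINTS ARE DELETION-MONOTONE FOR THE THRESHOLD FAMILY (p5, gen 23; `proofs/P5-GM1.md`
§21(l); paper INBOX 11540, Lean announced INBOX 11560)

At a `q`-generic non-loop `z` (p10's `GenericQ N z q`: every subset of `E ∖ z` of rank `≤ q` has `z` in the closure of
its complement), the threshold demand of the rank-`(q−1)` sets avoiding `z` is the same in `N` and `N ∖ z`, and the
sets through `z` are the sets of `N ／ z` one co-rank down with complement ranks shifted by exactly one; so
`thresholdSum N q t = thresholdSum (N ∖ z) q t + thresholdSum (N ／ z) (q−1) (t−1) + #L'` with `L'` the rank-`(q−2)`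
sets of `N ／ z` of co-rank `≥ t`, while the supply bound `card_levelSetCoQ_delete_add_le_of_genericQ` (p10's
`card_levelSetCoQ_delete_add_le` with the genericity at the level rather than at the co-rank threshold) gives
`#T(N) ≥ #T(N ∖ z) + #T'`.  Hence `DelMonoT N z q t` follows from `(I_{t−1})` at co-rank `q − 1` for `N ／ z`
(`2 ≤ q`, `q − 1 ≤ t`): the threshold family closes at `q`-generic points one co-rank down at the same offset
`t − q` — for `t = q + 1` the `u = q + 1` coloop band case at every `q`-generic point from `(I_q)` at co-rank
`q − 1` of `N ／ z`; the bad points of the rule are therefore among the hard points (data: exactly them).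

* `thresholdTerm_delete_of_generic`, `thresholdSum_delete_of_generic`,
  `thresholdTerm_insert_of_generic`, `thresholdSum_eq_delete_add_contract_of_generic`,
  `card_levelSetCoQ_delete_add_le_of_genericQ`, **`delMonoT_of_genericQ`**.
-/

open scoped Matroid

namespace PercRepro.Cogirth

open Finset ThmH Skew Shadow Profile

variable {α : Type} [DecidableEq α] {M : Matroid α} [M.Finite]

section ThresholdGeneric

variable {N : Matroid α} [N.Finite] {z : α} {q t : ℕ}

/-- At a `q`-generic `z` the complement rank of a rank-`(q−1)` set `B ∌ z` is the same in `N ∖ z` and in `N`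
(`z` lies in the closure of `E ∖ z ∖ B`). -/
theorem thresholdTerm_delete_of_generic (hz : z ∈ gr N) (hg : GenericQ N z q) {B : Finset α}
    (hB : B ∈ Rq N (q - 1)) (hzB : z ∉ B) :
    (if t + 1 ≤ rk (N ＼ ({z} : Set α)) (gr (N ＼ ({z} : Set α)) \ B) then
        rk (N ＼ ({z} : Set α)) (gr (N ＼ ({z} : Set α)) \ B) else 0) =
      (if t + 1 ≤ rk N (gr N \ B) then rk N (gr N \ B) else 0) := by
  rw [mem_Rq] at hB
  obtain ⟨hBg, hBr⟩ := hB
  have hrkB : rk N B = q - 1 := rk_eq_of_eRk_eq_cq hBr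
  have hBE : B ⊆ (gr N).erase z := subset_erase.2 ⟨hBg, hzB⟩
  have hX : (gr N).erase z \ B ⊆ (gr N).erase z := sdiff_subset
  have hcl : z ∈ clF N ((gr N).erase z \ B) := hg B hBE (by omega)
  have h1 : rk (N ＼ ({z} : Set α)) (gr (N ＼ ({z} : Set α)) \ B) = rk N ((gr N).erase z \ B) := by
    rw [gr_delete']
    exact rk_delete hX
  have h2 : gr N \ B = insert z ((gr N).erase z \ B) := by
    ext x
    simp only [mem_sdiff, mem_insert, mem_erase]
    constructor
    · rintro ⟨hx, hxB⟩
      by_cases hxz : x = z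
      · exact Or.inl hxz
      · exact Or.inr ⟨⟨hxz, hx⟩, hxB⟩
    · rintro (rfl | ⟨⟨_, hx⟩, hxB⟩)
      · exact ⟨hz, hzB⟩
      · exact ⟨hx, hxB⟩
  have h3 : rk N (gr N \ B) = rk N ((gr N).erase z \ B) := by
    rw [h2, rk_insert_eq hz (hX.trans (erase_subset _ _)), if_pos hcl]
  rw [h1, h3]

/-- At a `q`-generic `z` the threshold demand of `N ∖ z` is the threshold demand of the sets of `N` avoiding `z`. -/
theorem thresholdSum_delete_of_generic (hz : z ∈ gr N) (hg : GenericQ N z q) :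
    thresholdSum (N ＼ ({z} : Set α)) q t =
      ∑ B ∈ (Rq N (q - 1)).filter (fun B => z ∉ B),
        (if t + 1 ≤ rk N (gr N \ B) then rk N (gr N \ B) else 0) := by
  unfold thresholdSum
  rw [Rq_delete_eq_filter]
  refine sum_congr rfl (fun B hB => ?_)
  rw [mem_filter] at hB
  exact thresholdTerm_delete_of_generic hz hg hB.1 hB.2

/-- At a `q`-generic non-loop `z`, for a rank-`(q−2)` set `B'` of `N ／ z`: the threshold demand of `B' ∪ z` in `N`
is `[t ≤ r] · (r + 1)` with `r := ρ_{N／z}(E' ∖ B')` (`2 ≤ q`). -/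
theorem thresholdTerm_insert_of_generic (hzI : N.Indep {z}) (hg : GenericQ N z q) (hq : 2 ≤ q)
    {B' : Finset α} (hB' : B' ∈ Rq (N ／ ({z} : Set α)) (q - 2)) :
    (if t + 1 ≤ rk N (gr N \ insert z B') then rk N (gr N \ insert z B') else 0) =
      (if t ≤ rk (N ／ ({z} : Set α)) (gr (N ／ ({z} : Set α)) \ B') then
        rk (N ／ ({z} : Set α)) (gr (N ／ ({z} : Set α)) \ B') + 1 else 0) := by
  have hz : z ∈ gr N := mem_gr_of_indep hzI
  rw [mem_Rq, gr_contract'] at hB'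
  obtain ⟨hB'g, hB'r⟩ := hB'
  have hr' : rk (N ／ ({z} : Set α)) B' = q - 2 := rk_eq_of_eRk_eq_cq hB'r
  -- `ρ_N(B') ≤ q`: contracting lowers the rank by at most one
  have hrkB' : rk N B' ≤ q := by
    have h := rk_contract_add_one hzI hB'g
    rw [hr'] at h
    have h2 := rk_mono' (M := N) (subset_insert z B')
    omega
  have hY : (gr N).erase z \ B' ⊆ (gr N).erase z := sdiff_subset
  have hcl : z ∈ clF N ((gr N).erase z \ B') := hg B' hB'g hrkB'
  have h1 : gr N \ insert z B' = (gr N).erase z \ B' := by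
    ext x
    simp only [mem_sdiff, mem_insert, mem_erase, not_or]
    tauto
  have h2 : rk N ((gr N).erase z \ B') = rk (N ／ ({z} : Set α)) ((gr N).erase z \ B') + 1 := by
    rw [rk_contract_add_one hzI hY, rk_insert_eq hz (hY.trans (erase_subset _ _)), if_pos hcl]
  rw [h1, gr_contract', h2]
  by_cases hle : t ≤ rk (N ／ ({z} : Set α)) ((gr N).erase z \ B')
  · rw [if_pos (by omega), if_pos hle]
  · rw [if_neg (by omega), if_neg hle]

/-- **The threshold demand at a generic point splits**: `thresholdSum N q t = thresholdSum (N ∖ z) q t +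
thresholdSum (N ／ z) (q−1) (t−1) + #{B' : ρ_{N／z}(B') = q−2, ρ_{N／z}(E' ∖ B') ≥ t}` (`2 ≤ q`, `1 ≤ t`). -/
theorem thresholdSum_eq_delete_add_contract_of_generic (hzI : N.Indep {z}) (hg : GenericQ N z q) (hq : 2 ≤ q)
    (ht : 1 ≤ t) :
    thresholdSum N q t =
      thresholdSum (N ＼ ({z} : Set α)) q t +
        (thresholdSum (N ／ ({z} : Set α)) (q - 1) (t - 1) +
          ((Rq (N ／ ({z} : Set α)) (q - 2)).filter
            (fun B' => t ≤ rk (N ／ ({z} : Set α)) (gr (N ／ ({z} : Set α)) \ B'))).card) := by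
  have hz : z ∈ gr N := mem_gr_of_indep hzI
  have e1 : q - 1 - 1 = q - 2 := by omega
  have e2 : t - 1 + 1 = t := by omega
  have hsplit : thresholdSum N q t =
      ∑ B ∈ (Rq N (q - 1)).filter (fun B => z ∈ B),
          (if t + 1 ≤ rk N (gr N \ B) then rk N (gr N \ B) else 0) +
        ∑ B ∈ (Rq N (q - 1)).filter (fun B => z ∉ B),
          (if t + 1 ≤ rk N (gr N \ B) then rk N (gr N \ B) else 0) := by
    unfold thresholdSum
    rw [sum_filter_add_sum_filter_not]
  have hthru : ∑ B ∈ (Rq N (q - 1)).filter (fun B => z ∈ B),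
      (if t + 1 ≤ rk N (gr N \ B) then rk N (gr N \ B) else 0) =
      thresholdSum (N ／ ({z} : Set α)) (q - 1) (t - 1) +
        ((Rq (N ／ ({z} : Set α)) (q - 2)).filter
          (fun B' => t ≤ rk (N ／ ({z} : Set α)) (gr (N ／ ({z} : Set α)) \ B'))).card := by
    rw [sum_Rq_filter_mem_contract hzI (by omega : 1 ≤ q - 1), e1]
    rw [sum_congr rfl (fun B' hB' => thresholdTerm_insert_of_generic (t := t) hzI hg hq hB')]
    unfold thresholdSum
    rw [e1, e2, card_filter, ← sum_add_distrib]
    refine sum_congr rfl (fun B' _ => ?_)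
    split_ifs <;> omega
  rw [hsplit, hthru, thresholdSum_delete_of_generic (t := t) hz hg]
  ring

/-- **The supply bound at a `q`-generic non-loop point, at every co-rank threshold `t ≥ 1`**:
`#T_t(N ∖ z) + #T'_{t−1}(N ／ z) ≤ #T_t(N)` — the sets of `N ∖ z` are sets of `N`, and `S' ↦ S' ∪ z` maps the
co-rank-`(t−1)` rank-`(q−1)` sets of `N ／ z` into the co-rank-`t` rank-`q` sets of `N` (`z` lies in the closure of
`E ∖ z ∖ S'`, so the complement rank rises by exactly one). -/
theorem card_levelSetCoQ_delete_add_le_of_genericQ (hzI : N.Indep {z}) (hg : GenericQ N z q) (hq : 1 ≤ q)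
    (ht : 1 ≤ t) :
    (levelSetCoQ (N ＼ ({z} : Set α)) t q).card + (levelSetCoQ (N ／ ({z} : Set α)) (t - 1) (q - 1)).card ≤
      (levelSetCoQ N t q).card := by
  have hz : z ∈ gr N := mem_gr_of_indep hzI
  -- the through-`z` image
  have hgood : ∀ S' ∈ levelSetCoQ (N ／ ({z} : Set α)) (t - 1) (q - 1), t ≤ rk N ((gr N).erase z \ S') := by
    intro S' hS'
    rw [mem_levelSetCoQ, gr_contract'] at hS'
    obtain ⟨⟨hS'g, hS'r⟩, hS'c⟩ := hS'
    have hr' : rk (N ／ ({z} : Set α)) S' = q - 1 := rk_eq_of_eRk_eq_cq hS'r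
    have hrkS' : rk N S' ≤ q := by
      have h := rk_contract_add_one hzI hS'g
      rw [hr'] at h
      have h2 := rk_mono' (M := N) (subset_insert z S')
      omega
    have hY : (gr N).erase z \ S' ⊆ (gr N).erase z := sdiff_subset
    have hcl : z ∈ clF N ((gr N).erase z \ S') := hg S' hS'g hrkS'
    have h2 : rk N ((gr N).erase z \ S') = rk (N ／ ({z} : Set α)) ((gr N).erase z \ S') + 1 := by
      rw [rk_contract_add_one hzI hY, rk_insert_eq hz (hY.trans (erase_subset _ _)), if_pos hcl]
    omega
  have himage : (levelSetCoQ (N ／ ({z} : Set α)) (t - 1) (q - 1)).image (fun S' => insert z S') ⊆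
      levelSetCoQ N t q := by
    intro S hS
    rw [mem_image] at hS
    obtain ⟨S', hS', rfl⟩ := hS
    exact mem_levelSetCoQ_of_generic_good hzI (q := t) (u := q) hq hS' (hgood S' hS')
  have hinj : Set.InjOn (fun S' => insert z S')
      ((levelSetCoQ (N ／ ({z} : Set α)) (t - 1) (q - 1) : Finset (Finset α)) : Set (Finset α)) := by
    intro S₁ hS₁ S₂ hS₂ heq
    have hz₁ : z ∉ S₁ := by
      have := (mem_levelSetCoQ.1 hS₁).1.1
      rw [gr_contract'] at this
      exact fun h => (mem_erase.1 (this h)).1 rfl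
    have hz₂ : z ∉ S₂ := by
      have := (mem_levelSetCoQ.1 hS₂).1.1
      rw [gr_contract'] at this
      exact fun h => (mem_erase.1 (this h)).1 rfl
    have h1 : S₁ = (insert z S₁).erase z := (erase_insert hz₁).symm
    have h2 : S₂ = (insert z S₂).erase z := (erase_insert hz₂).symm
    rw [h1, h2]
    exact congrArg (fun S => S.erase z) heq
  have hdisj : Disjoint (levelSetCoQ (N ＼ ({z} : Set α)) t q)
      ((levelSetCoQ (N ／ ({z} : Set α)) (t - 1) (q - 1)).image (fun S' => insert z S')) := by
    rw [disjoint_left]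
    intro S hS hS'
    have hSg := (mem_levelSetCoQ.1 hS).1.1
    rw [gr_delete'] at hSg
    rw [mem_image] at hS'
    obtain ⟨S', _, rfl⟩ := hS'
    exact (mem_erase.1 (hSg (mem_insert_self z S'))).1 rfl
  calc (levelSetCoQ (N ＼ ({z} : Set α)) t q).card +
        (levelSetCoQ (N ／ ({z} : Set α)) (t - 1) (q - 1)).card
      = (levelSetCoQ (N ＼ ({z} : Set α)) t q).card +
        ((levelSetCoQ (N ／ ({z} : Set α)) (t - 1) (q - 1)).image (fun S' => insert z S')).card := by
          rw [card_image_of_injOn hinj]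
    _ = ((levelSetCoQ (N ＼ ({z} : Set α)) t q) ∪
        (levelSetCoQ (N ／ ({z} : Set α)) (t - 1) (q - 1)).image (fun S' => insert z S')).card := by
          rw [card_union_of_disjoint hdisj]
    _ ≤ (levelSetCoQ N t q).card :=
          card_le_card (union_subset (levelSetCoQ_delete_subset_gen z t q) himage)

/-- **Deletion monotonicity of the threshold gap at a `q`-generic non-loop point, from the family one co-rank
down** (`2 ≤ q`, `q − 1 ≤ t`): `DelMonoT N z q t` follows from `(I_{t−1})` at co-rank `q − 1` for `N ／ z`. -/
theorem delMonoT_of_genericQ (hzI : N.Indep {z}) (hg : GenericQ N z q) (hq : 2 ≤ q) (hqt : q - 1 ≤ t)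
    (h : ThresholdIneq (N ／ ({z} : Set α)) (q - 1) (t - 1)) : DelMonoT N z q t := by
  have hgq : GenericQ N z q := hg
  unfold DelMonoT
  rw [thresholdSum_eq_delete_add_contract_of_generic hzI hgq hq (by omega)]
  unfold ThresholdIneq at h
  have e1 : q - 1 - 1 = q - 2 := by omega
  have e2 : t - 1 + 1 = t := by omega
  -- the supply bound at a `q`-generic point (co-rank threshold `t`, level `q`)
  have hsupply := card_levelSetCoQ_delete_add_le_of_genericQ (t := t) hzI hg (by omega) (by omega)
  -- `#L' ≤ #T'`: every member of `L'` has demand `≥ t`, and `t · #T' ≥ (q−1) · #T' ≥ thresholdSum'`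
  set L' := (Rq (N ／ ({z} : Set α)) (q - 2)).filter
    (fun B' => t ≤ rk (N ／ ({z} : Set α)) (gr (N ／ ({z} : Set α)) \ B')) with hL'
  have hLsum : t * L'.card ≤ thresholdSum (N ／ ({z} : Set α)) (q - 1) (t - 1) := by
    unfold thresholdSum
    rw [e1, e2, hL', card_filter, mul_sum]
    refine sum_le_sum (fun B' _ => ?_)
    split_ifs <;> omega
  have hT' : L'.card ≤ (levelSetCoQ (N ／ ({z} : Set α)) (t - 1) (q - 1)).card := by
    have h3 : t * L'.card ≤ t * (levelSetCoQ (N ／ ({z} : Set α)) (t - 1) (q - 1)).card := by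
      calc t * L'.card ≤ thresholdSum (N ／ ({z} : Set α)) (q - 1) (t - 1) := hLsum
        _ ≤ (q - 1) * (levelSetCoQ (N ／ ({z} : Set α)) (t - 1) (q - 1)).card := h
        _ ≤ t * (levelSetCoQ (N ／ ({z} : Set α)) (t - 1) (q - 1)).card :=
            Nat.mul_le_mul_right _ (by omega)
    exact Nat.le_of_mul_le_mul_left h3 (by omega)
  -- assemble
  have hA : thresholdSum (N ／ ({z} : Set α)) (q - 1) (t - 1) + L'.card ≤
      q * (levelSetCoQ (N ／ ({z} : Set α)) (t - 1) (q - 1)).card := by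
    have hq1 : (q - 1) * (levelSetCoQ (N ／ ({z} : Set α)) (t - 1) (q - 1)).card +
        (levelSetCoQ (N ／ ({z} : Set α)) (t - 1) (q - 1)).card =
        q * (levelSetCoQ (N ／ ({z} : Set α)) (t - 1) (q - 1)).card := by
      have hq' : q - 1 + 1 = q := Nat.sub_add_cancel (by omega : 1 ≤ q)
      calc (q - 1) * (levelSetCoQ (N ／ ({z} : Set α)) (t - 1) (q - 1)).card +
            (levelSetCoQ (N ／ ({z} : Set α)) (t - 1) (q - 1)).card
          = (q - 1 + 1) * (levelSetCoQ (N ／ ({z} : Set α)) (t - 1) (q - 1)).card := by ring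
        _ = q * (levelSetCoQ (N ／ ({z} : Set α)) (t - 1) (q - 1)).card := by rw [hq']
    omega
  have hB : q * (levelSetCoQ (N ＼ ({z} : Set α)) t q).card +
      q * (levelSetCoQ (N ／ ({z} : Set α)) (t - 1) (q - 1)).card ≤ q * (levelSetCoQ N t q).card := by
    rw [← Nat.mul_add]
    exact Nat.mul_le_mul_left q hsupply
  omega

end ThresholdGeneric

end PercRepro.Cogirth
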